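import Summits.KontsevichZagierPeriods.KontsevichZagierPeriods.Theorems.LinRedNormalFormArrangementNormalFormStubRebaseSimpleZeroNestedDiffFrameTools

/-!
# Stub `stub_rebaseSimpleZeroTwo`, part `rebaseSimpleZero_nestedDifferent` (crux
`ArrangementNormalForm`, line `janus-bands`) — brick `NestedDiffCTools`

Dictionary for **type C** of the rebase of a nested pair `A(y) < tᵢ < tⱼ < B(y)` with letters of
different `y`-slopes (both bounds letter-parallel: `A ∥ cᵢ`, `B ∥ cⱼ`): the LETTER–LETTER
expansion (rule 1b)

  `1/((tᵢ − cᵢ)(tⱼ − cⱼ)) = (1/R) · (1/(tᵢ − cᵢ) − 1/(tⱼ − cⱼ))`,  `R := (tⱼ − cⱼ(y)) − (tᵢ − cᵢ(y))`,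

whose two pieces `f · (tⱼ − cⱼ)/R` and `f · (−(tᵢ − cᵢ))/R` converge absolutely as soon as
`|tⱼ − cⱼ| ≤ C |R|` on the domain (`RebaseDiff.facCi/facCj`, `RebaseDiff.abs_facC_le`; automatic
when the two letter forms have opposite signs, `RebaseDiff.dominatedC_of_signs`), and the
REFLECTION CHART `tₗ ↦ t_{l'} + c(y) − tₗ` of one fibre through the other fibre shifted by an
affine form of the base (`RebaseDiff.coefR/xR`, an instance of the rank-one map `RebaseDiff.rkMap`
with Jacobian `−1`, an involution): it maps the clean nest onto itself and turns the wall `R = 0`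
into a letter of the reflected fibre PARALLEL to the letter of the other one. Registered:
`rebaseSimpleZero_letterLetterSplit` (the two factors sum to `1` off the wall).

References: M. Kontsevich, D. Zagier, *Periods* (2001), §1.2, rules (1b), (2).
-/

noncomputable section

open Set MeasureTheory MvPolynomial
open Literature.NumberTheory.Transcendental Literature.ModelTheory.ExponentialFields

namespace Summit.KontsevichZagierPeriods.ArrangementNormalForm.JanusBands

namespace RebaseDiff

open SeparatePos RebasePos RebaseZero RebaseNest

/-! ### The two factors of the letter–letter expansion -/

section Factors

variable (i j : Fin 2) (ci cj : Cf)

/-- The wall `R = (tⱼ − cⱼ(y)) − (tᵢ − cᵢ(y))` of the letter–letter expansion. -/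
def wallC (z : Fin (0 + 1 + 2) → ℝ) : ℝ := (tv z j - ev cj (yv z)) - (tv z i - ev ci (yv z))

/-- The factor `(tⱼ − cⱼ)/R` of the piece keeping the letter of `tᵢ`. -/
def facCi (z : Fin (0 + 1 + 2) → ℝ) : ℝ := (tv z j - ev cj (yv z)) / wallC i j ci cj z

/-- The factor `−(tᵢ − cᵢ)/R` of the piece keeping the letter of `tⱼ`. -/
def facCj (z : Fin (0 + 1 + 2) → ℝ) : ℝ := -(tv z i - ev ci (yv z)) / wallC i j ci cj z

/-- The two factors sum to `1` off the wall. -/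
theorem facCi_add_facCj (z : Fin (0 + 1 + 2) → ℝ) (hR : wallC i j ci cj z ≠ 0) :
    facCi i j ci cj z + facCj i j ci cj z = 1 := by
  rw [facCi, facCj, ← add_div, div_eq_one_iff_eq hR, wallC]
  ring

/-- The wall is semialgebraic. -/
theorem isSemialgebraicFunOn_wallC {S : Set (Fin (0 + 1 + 2) → ℝ)} (hS : IsSemialgebraic ℚ S) :
    IsSemialgebraicFunOn ℚ S (wallC i j ci cj) :=
  (isSemialgebraicFunOn_aeval hS (letterPoly j cj - letterPoly i ci)).congr fun z _ => by
    show aeval z (letterPoly j cj - letterPoly i ci) = _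
    rw [map_sub, aeval_letterPoly, aeval_letterPoly]; rfl

/-- `facCi` is semialgebraic. -/
theorem isSemialgebraicFunOn_facCi {S : Set (Fin (0 + 1 + 2) → ℝ)} (hS : IsSemialgebraic ℚ S) :
    IsSemialgebraicFunOn ℚ S (facCi i j ci cj) :=
  IntegrateOut.isSemialgebraicFunOn_div (isSemialgebraicFunOn_letter hS j cj) (isSemialgebraicFunOn_wallC i j ci cj hS)

/-- `facCj` is semialgebraic. -/
theorem isSemialgebraicFunOn_facCj {S : Set (Fin (0 + 1 + 2) → ℝ)} (hS : IsSemialgebraic ℚ S) :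
    IsSemialgebraicFunOn ℚ S (facCj i j ci cj) :=
  IntegrateOut.isSemialgebraicFunOn_div (isSemialgebraicFunOn_letter hS i ci).neg
    (isSemialgebraicFunOn_wallC i j ci cj hS)

/-- **Domination bounds.** If `|tⱼ − cⱼ| ≤ C |R|` on `S` and the letter of `tⱼ` does not vanish
there, both factors are bounded on `S`. -/
theorem abs_facC_le {S : Set (Fin (0 + 1 + 2) → ℝ)} (C : ℝ)
    (hC : ∀ z ∈ S, |tv z j - ev cj (yv z)| ≤ C * |wallC i j ci cj z|)
    (hne : ∀ z ∈ S, tv z j ≠ ev cj (yv z)) (z : Fin (0 + 1 + 2) → ℝ) (hz : z ∈ S) :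
    wallC i j ci cj z ≠ 0 ∧ |facCi i j ci cj z| ≤ C ∧ |facCj i j ci cj z| ≤ C + 1 := by
  have hR : wallC i j ci cj z ≠ 0 := fun h => by
    have := hC z hz
    rw [h, abs_zero, mul_zero] at this
    exact hne z hz (sub_eq_zero.1 (abs_eq_zero.1 (le_antisymm this (abs_nonneg _))))
  have hRpos : 0 < |wallC i j ci cj z| := abs_pos.2 hR
  have h1 : |facCi i j ci cj z| ≤ C := by
    rw [facCi, abs_div, div_le_iff₀ hRpos]
    exact hC z hz
  refine ⟨hR, h1, ?_⟩
  have h2 : facCj i j ci cj z = 1 - facCi i j ci cj z := by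
    rw [← facCi_add_facCj i j ci cj z hR]; ring
  rw [h2]
  calc |1 - facCi i j ci cj z| ≤ |(1 : ℝ)| + |facCi i j ci cj z| := abs_sub _ _
    _ ≤ C + 1 := by rw [abs_one]; linarith

/-- **Automatic domination by signs.** If `tⱼ − cⱼ` and `tᵢ − cᵢ` have opposite (weak) signs at
`z`, then `|tⱼ − cⱼ| ≤ |R|` at `z`. -/
theorem dominatedC_of_signs (ε : ℝ) (hε : ε = 1 ∨ ε = -1) (z : Fin (0 + 1 + 2) → ℝ)
    (hP : 0 ≤ ε * (tv z j - ev cj (yv z))) (hQ : ε * (tv z i - ev ci (yv z)) ≤ 0) :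
    |tv z j - ev cj (yv z)| ≤ 1 * |wallC i j ci cj z| := by
  rw [one_mul, wallC]
  rcases hε with rfl | rfl
  · rw [one_mul] at hP hQ
    rw [abs_of_nonneg hP, abs_of_nonneg (by linarith)]
    linarith
  · rw [abs_of_nonpos (by linarith), abs_of_nonpos (by linarith)]
    linarith

end Factors

/-! ### The reflection chart of one fibre through the other -/

section ChartR

variable {l l' : Fin 2} (hll : l ≠ l') (c : Cf)

/-- Coefficients of the rank-one functional of the reflection chart
`tₗ ↦ t_{l'} + c(y) − tₗ`: `t_{l'} + c₁ y − 2 tₗ`. -/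
def coefR (l l' : Fin 2) (c : Cf) : Fin (0 + 1 + 2) → ℚ :=
  Function.update (Function.update (Function.update 0 (tIdx l') 1) (yIdx 2) (c.1 (Fin.last 0))) (tIdx l) (-2)

/-- The updated direction of the reflection chart: the fibre `l`. -/
def xR (l : Fin 2) : Fin (0 + 1 + 2) → ℚ := Pi.single (tIdx l) 1

/-- The coefficient of `tₗ`. -/
theorem coefR_self : coefR l l' c (tIdx l) = -2 := by
  simp [coefR]

/-- The coefficient of `y`. -/
theorem coefR_y : coefR l l' c (yIdx 2) = c.1 (Fin.last 0) := by
  rw [coefR, Function.update_of_ne (yIdx_ne_tIdx l), Function.update_self]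

include hll in
/-- The coefficient of `t_{l'}`. -/
theorem coefR_other : coefR l l' c (tIdx l') = 1 := by
  rw [coefR, Function.update_of_ne (tIdx_injective.ne hll.symm), Function.update_of_ne (yIdx_ne_tIdx l').symm,
    Function.update_self]

include hll in
/-- The functional of the reflection chart. -/
theorem rkSumR (w : Fin (0 + 1 + 2) → ℝ) :
    ∑ k, (coefR l l' c k : ℝ) * w k = tv w l' + (c.1 (Fin.last 0) : ℝ) * yv w - 2 * tv w l := by
  rw [sum_coord hll, coefR_y, coefR_self, coefR_other hll]
  simp only [tv, yv]
  push_cast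
  ring

/-- The Jacobian number of the reflection chart is `−1`. -/
theorem rkJac_R : rkJac (coefR l l' c) (xR l) = -1 := by
  have h : ∑ k, coefR l l' c k * xR l k = coefR l l' c (tIdx l) := by
    simp only [xR, Pi.single_apply, mul_ite, mul_one, mul_zero, Finset.sum_ite_eq', Finset.mem_univ, if_true]
  rw [rkJac, h, coefR_self]
  norm_num

/-- The Jacobian number of the reflection chart does not vanish. -/
theorem rkJac_R_ne : rkJac (coefR l l' c) (xR l) ≠ 0 := by
  rw [rkJac_R]; norm_num

include hll in
/-- **The reflection chart on the reflected fibre**: `tₗ ↦ t_{l'} + c(y) − tₗ`. -/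
theorem tv_psiR_self (w : Fin (0 + 1 + 2) → ℝ) :
    tv (rkMap (coefR l l' c) (xR l) c.2 w) l = tv w l' + ev c (yv w) - tv w l := by
  show rkMap (coefR l l' c) (xR l) c.2 w (tIdx l) = _
  rw [rkMap_apply, rkSumR hll, ev]
  simp only [xR, Pi.single_eq_same, Rat.cast_one, mul_one]
  show tv w l + _ = _
  ring

include hll in
/-- The reflection chart fixes the other fibre. -/
theorem tv_psiR_other (w : Fin (0 + 1 + 2) → ℝ) : tv (rkMap (coefR l l' c) (xR l) c.2 w) l' = tv w l' := by
  show rkMap (coefR l l' c) (xR l) c.2 w (tIdx l') = _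
  rw [rkMap_apply]
  simp only [xR, Pi.single_eq_of_ne (tIdx_injective.ne hll.symm), Rat.cast_zero, mul_zero, add_zero]
  rfl

/-- The reflection chart fixes the base. -/
theorem yv_psiR (w : Fin (0 + 1 + 2) → ℝ) : yv (rkMap (coefR l l' c) (xR l) c.2 w) = yv w := by
  show rkMap (coefR l l' c) (xR l) c.2 w (yIdx 2) = _
  rw [rkMap_apply]
  simp only [xR, Pi.single_eq_of_ne (yIdx_ne_tIdx l), Rat.cast_zero, mul_zero, add_zero]
  rfl

include hll in
/-- **The inverse reflection chart is the same reflection** (an involution), on the fibre `l`. -/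
theorem tv_invR_self (z : Fin (0 + 1 + 2) → ℝ) :
    tv (rkInv (coefR l l' c) (xR l) c.2 z) l = tv z l' + ev c (yv z) - tv z l := by
  show rkInv (coefR l l' c) (xR l) c.2 z (tIdx l) = _
  rw [rkInv_apply, rkSumR hll, rkJac_R, ev]
  simp only [xR, Pi.single_eq_same, Rat.cast_one, mul_one, Rat.cast_neg, div_neg, div_one]
  show tv z l - _ = _
  ring

include hll in
/-- The inverse reflection chart fixes the other fibre. -/
theorem tv_invR_other (z : Fin (0 + 1 + 2) → ℝ) : tv (rkInv (coefR l l' c) (xR l) c.2 z) l' = tv z l' := by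
  show rkInv (coefR l l' c) (xR l) c.2 z (tIdx l') = _
  rw [rkInv_apply]
  simp only [xR, Pi.single_eq_of_ne (tIdx_injective.ne hll.symm), Rat.cast_zero, mul_zero, sub_zero]
  rfl

/-- The inverse reflection chart fixes the base. -/
theorem yv_invR (z : Fin (0 + 1 + 2) → ℝ) : yv (rkInv (coefR l l' c) (xR l) c.2 z) = yv z := by
  show rkInv (coefR l l' c) (xR l) c.2 z (yIdx 2) = _
  rw [rkInv_apply]
  simp only [xR, Pi.single_eq_of_ne (yIdx_ne_tIdx l), Rat.cast_zero, mul_zero, sub_zero]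
  rfl

end ChartR

end RebaseDiff

/-- Registered support goal of this file (brick of `rebaseSimpleZero_nestedDifferent`): the two
factors of the letter–letter expansion (rule 1b)
`1/((tᵢ − cᵢ)(tⱼ − cⱼ)) = (1/R)(1/(tᵢ − cᵢ) − 1/(tⱼ − cⱼ))`, `R = (tⱼ − cⱼ(y)) − (tᵢ − cᵢ(y))`,
sum to `1` off the wall `R = 0` (`RebaseDiff.facCi_add_facCj`). -/
theorem rebaseSimpleZero_letterLetterSplit (i j : Fin 2) (ci cj : (Fin (0 + 1) → ℚ) × ℚ) (z : Fin (0 + 1 + 2) → ℝ) (hR : RebaseDiff.wallC i j ci cj z ≠ 0) : RebaseDiff.facCi i j ci cj z + RebaseDiff.facCj i j ci cj z = 1 :=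
  RebaseDiff.facCi_add_facCj i j ci cj z hR

end Summit.KontsevichZagierPeriods.ArrangementNormalForm.JanusBands
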